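import Summits.QuantumFields.YangMills.Theorems.BalabanUVNodesN06SectBQLawsKnit
import Literature.MathematicalPhysics.QuantumFieldTheory.Balaban1983to89.B9SectBQVarLawsOfKernelY
import Literature.MathematicalPhysics.QuantumFieldTheory.Balaban1983to89.B9Eq380QknitVariationY

/-!
# Balaban UV-stability nodes, N06 [B9] Sect. B — «P-Q80-knit» F3b: THE K2-G VARIATION LAWS `hQ80` (block-sup) AND `hQL280` (block-`ℓ²`) INHABITED AT PRINT's
# KNIT AVERAGING PAIR `(Q(U), Q*(U)) = (QknitY i U, adjTrY (QknitY i U))` ([B8] Prop. 2) for a member family, `𝔸 = M_N(ℂ)`, `G ≤ U(N)` — from the knit row form of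
# (3.80)–(3.81) (`B9Eq380QknitVariationY`), the generic packaging (`B9SectBQVarLawsOfKernelY`) and the instance class's three displayed laws (def-Y's (K3) shape:
# (3.35) base datum · (3.37) smallness on the end blocks · `3cAβ′ ≤ ϱ′`); the end-block law is discharged from r06's nested class (3.37) by file 3a §4

[B9] = T. Bałaban, *Propagators for lattice gauge theories in a background field*, Commun. Math. Phys. **99** (1985) 389–434 [`Balaban1985BackgroundPropagators`];
[4] = [`Balaban1984PropagatorsII`]; [B8] = T. Bałaban, *Averaging operations for lattice gauge theories*, CMP **98** (1985) [`Balaban1985Averaging`].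

statement-level skeleton of published theorems with citation tags; proofs where landed; nothing here is a claim about the Yang–Mills mass gap

WHAT (seat `pub-ymgap-dag-n06-l` gen 39; dag-lead WORDS 490∕498∕503: «n06-l owns `hQ80 ∕ hQL280` = P-Q80-knit»; node00-def-Y SCOPING 2026-08-30 21:36Z, class (K3)).
§1 the VARIATION KERNEL `k80(κ,f) = (9∕(2ϱ′))·α₁·boxK κ f`: sign, row mass `≦ (9∕(2ϱ′))·α₁·2(d+1)` (`sum_boxK_le`), support radius `ℓ + 4` in the labelled blocks
(`dist_le_of_boxK_ne_zero_bI`, `geo9K_dist_lab_repBondY_self`), plateau `vol(κ)·boxK κ f ≦ 1`, block-restricted volume-weighted column mass `≦ 2(d+1)·(9∕(2ϱ′))·α₁`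
(r03's `card_fiber_beta_le`, dag-n06-c's `sum_indB_vol_knitRow_le` pattern); `adjTrY_sub`.
§2 ★★ `knit_variation_kernel_data` — per member background `U` of `(bg9KP M_N(ℂ) G i).Reg335 c₀ α₀` and complex `a` with `Lʲη·‖a_μ(x)‖ ≦ α₁` on the end blocks of every
index bond (`3α₁ ≦ ϱ′`), under the x-free numerics of `B9Eq380QknitVariationY`: the 10-tuple of kernel facts for the DIFFERENCES `Q(e^{iηa}U) − Q(U)` (rows, `norm_QknitY_mulY_sub_apply_le`)
and `adjTrY Q(e^{iηa}U) − adjTrY Q(U) = adjTrY (Q(e^{iηa}U) − Q(U))` (columns, dag-n06-l g37 `norm_adjTrY_apply_le_of_rowKernel`) with kernels `(k80, N⁴·k80)`, masses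
`≦ C80·α₁`, `C80 := N⁴·(9∕(2ϱ′))·2(d+1)`, radius `ℓ + 4` (both support keys) — EXACTLY the per-`(j, β′, U, a)` conjunct of `B9SectBQVarLawsOfKernelY.hQ80_of_kernels ∕
hQL280_of_kernels`' `hker`.
§3 ★★★ `hQ80_knit` ∕ ★★★ `hQL280_knit` — the binders `hQ80` ∕ `hQL280` of `B9SectBStepUParGQOfMembers.sectBStepUParGQ_of_members` VERBATIM at the knit pair of a member
family (`h𝔮 : 𝔮 j U = QknitY _ U`, `h𝔮s : 𝔮s j U = adjTrY (QknitY _ U)`), the instance's class `C37` abstract with THREE displayed laws — `hC37R` (the base's (3.35) datum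
`∃ α₀, 0 < α₀ ∧ M·α₀ ≦ aInv ∧ (bg9YC …).Reg335 c35 α₀ U`), `hC37A` ((3.37) on the end blocks: `Lʲη·‖a_μ(x)‖ ≦ cA·β′`), `hC37ϱ` (`3cAβ′ ≦ ϱ′`) — KC's standing regime bridge
`hRP` and knit numerics `hKpl`, and the x-free window of file 2; `cF := (M₂Σ‖b_j‖)·(C80·cA)·e^{ℓ+4}`, `cF2 := (√|ι|·M₂Σ‖b_j‖)·(C80·cA)·e^{ℓ+4}`.
(The discharge of `hC37A` from r06's NESTED class (3.37) with `cA = L` is `B9SectBQVarLawsOfKernelY.endBlock_small_of_cplx337`, file 3a §4.)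

HONEST SCOPE.  Bookkeeping over landed kernel theorems (file 2's Cauchy-route estimate is the only analysis, LANDED); the class laws, regime bridge and numerics are
HYPOTHESES; crude constants; count-neutral; N06 NOT discharged; K1⁹ NOT closed; nothing continuum ∕ OS ∕ mass-gap ∕ Clay — the Yang–Mills mass gap is NOT proved here.
0 `def`, 0 `sorry`, no `instance`, no `notation`.  `--supports stmt-QuantumFields-27364 --as helper`.
-/

noncomputable section

namespace Summit.QuantumFields.YangMills.BalabanUVNodes.N06SectBQVarLawsKnit

open scoped Matrix Matrix.Norms.L2Operator
open Literature.MathematicalPhysics.QuantumFieldTheory.Balaban1983to89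
open Literature.MathematicalPhysics.QuantumFieldTheory.Balaban1983to89.Node00 (SiteY BlkY FBondY IBondY CfgY repBondY bondCoordsY)
open Literature.MathematicalPhysics.QuantumFieldTheory.Balaban1983to89.Node00.OpsYQLetter (adjTrY adjTrY_apply trSesqY unitFnY)
open Literature.MathematicalPhysics.QuantumFieldTheory.Balaban1983to89.B6Ineq2142KLevelV1 (lvl β)
open Literature.MathematicalPhysics.QuantumFieldTheory.Balaban1983to89.B6GlobalChartV1 (PV blkV1 boxEquiv)
open Literature.MathematicalPhysics.QuantumFieldTheory.Balaban1983to89.B6KLevelCensusIndexV1 (KIdx kGeo)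
open Literature.MathematicalPhysics.QuantumFieldTheory.Balaban1983to89.B6RandomWalk (HasMajorant)
open Literature.MathematicalPhysics.QuantumFieldTheory.Balaban1983to89.B6RandomWalkL2 (HasL2Majorant)
open Literature.MathematicalPhysics.QuantumFieldTheory.Balaban1983to89.B9Thm34Ext (toB6)
open Literature.MathematicalPhysics.QuantumFieldTheory.Balaban1983to89.B9GeoNormsKLevelV1 (geo9K)
open Literature.MathematicalPhysics.QuantumFieldTheory.Balaban1983to89.B9GeoLemma21KLevelV1 (geo9K_dist_comm geo9K_dist_triangle one_le_k)
open Literature.MathematicalPhysics.QuantumFieldTheory.Balaban1983to89.B6Prop27KLevelV1 (card_fiber_beta_le)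
open Literature.MathematicalPhysics.QuantumFieldTheory.Balaban1983to89.B9PinMembersKLevelV1 (MemberY geo9Y)
open Literature.MathematicalPhysics.QuantumFieldTheory.Balaban1983to89.B9BackgroundsKLevelV1P (bg9KP)
open Literature.MathematicalPhysics.QuantumFieldTheory.Balaban1983to89.B9SectBCodedClassR (RegExtraY bg9YC)
open Literature.MathematicalPhysics.QuantumFieldTheory.Balaban1983to89.B9Eq360DeltaPrimeAY (AfldY)
open Literature.MathematicalPhysics.QuantumFieldTheory.Balaban1983to89.B9SectBGpLettersY (blkC decY decY_prod)
open Literature.MathematicalPhysics.QuantumFieldTheory.Balaban1983to89.B9SectBGWordDeltaAY (volY volY_pos)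
open Literature.MathematicalPhysics.QuantumFieldTheory.Balaban1983to89.B9SectBGWordDeltaAQY (F₂QC F₂sQC)
open Literature.MathematicalPhysics.QuantumFieldTheory.Balaban1983to89.B9SectBQLettersL2QY (F₂QC2 F₂sQC2)
open Literature.MathematicalPhysics.QuantumFieldTheory.Balaban1983to89.B9SectBL2GReadY (indB)
open Literature.MathematicalPhysics.QuantumFieldTheory.Balaban1983to89.B9SectBQLettersL2Y (indB_of_eq indB_of_ne)
open Literature.MathematicalPhysics.QuantumFieldTheory.Balaban1983to89.B9SectBQVarLawsOfKernelY (hQ80_of_kernels hQL280_of_kernels)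
open Literature.MathematicalPhysics.QuantumFieldTheory.Balaban1983to89.B7Prop2Explicit (unitaryUnits unitaryUnits_le_U1 C0 c2')
open Literature.MathematicalPhysics.QuantumFieldTheory.Balaban1983to89.B7Prop3Flat (c3)
open Literature.MathematicalPhysics.QuantumFieldTheory.Balaban1983to89.B7Prop5CplxLevels (epsCplx tauCplx)
open Literature.MathematicalPhysics.QuantumFieldTheory.Balaban1983to89.B5Eq118OneStroke (iterBlockOf)
open Literature.MathematicalPhysics.QuantumFieldTheory.Balaban1983to89.B9Eq3115KnitLetterY (QknitY)
open Literature.MathematicalPhysics.QuantumFieldTheory.Balaban1983to89.B9Eq3115KnitLetterYRowCloseness (boxK boxK_nonneg boxK_le sum_boxK_le)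
open Literature.MathematicalPhysics.QuantumFieldTheory.Balaban1983to89.B9Eq380QknitVariationY (norm_QknitY_mulY_sub_apply_le)
open Literature.MathematicalPhysics.QuantumFieldTheory.Balaban1983to89.B9C2FormBoxRegimeY (Kpl)
open Summit.QuantumFields.YangMills.BalabanUVNodes.N06Thm312313ParLawsQRow (dist_le_of_boxK_ne_zero_bI)
open Summit.QuantumFields.YangMills.BalabanUVNodes.N06Thm312313ParLawsQStar (norm_adjTrY_apply_le_of_rowKernel)
open Summit.QuantumFields.YangMills.BalabanUVNodes.N06SectBQLawsKnit (hβ1_blkV1)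

variable {d ℓ : ℕ} {hd : 1 ≤ d + 1} {hL : Odd (ℓ + 1) ∧ 1 < ℓ + 1} {b₀ b₁ : ℝ}
variable (i : KIdx d ℓ hd hL b₀ b₁) (ιB : BlkY i → IBondY i)

/-! ## §1 The variation kernel `k80 = (9∕(2ϱ′))·α₁·boxK`: sign, row mass, support, block-restricted volume-weighted column mass; `adjTrY` of a difference -/

/-- `k80 ≧ 0`. [cite: Balaban1985BackgroundPropagators, (3.81) p.406; Balaban1985Averaging, (141) p.39, bookkeeping] -/
theorem k80_nonneg {ϱ' α₁ : ℝ} (hϱ : 0 ≤ ϱ') (hα₁ : 0 ≤ α₁) (κ : IBondY i) (f : FBondY i) : 0 ≤ 9 / (2 * ϱ') * α₁ * boxK i κ f :=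
  mul_nonneg (mul_nonneg (by positivity) hα₁) (boxK_nonneg i κ f)

/-- the row mass of `k80`: `Σ_f k80(κ,f) ≦ (9∕(2ϱ′))·α₁·2(d+1)` (`sum_boxK_le`). [cite: Balaban1985BackgroundPropagators, (3.81) p.406 («O(1)α₁Q″_j»); Balaban1985Averaging, (140)–(141) p.39] -/
theorem sum_k80_le {ϱ' α₁ : ℝ} (hϱ : 0 ≤ ϱ') (hα₁ : 0 ≤ α₁) (κ : IBondY i) :
    ∑ f, 9 / (2 * ϱ') * α₁ * boxK i κ f ≤ 9 / (2 * ϱ') * α₁ * (2 * ((d : ℝ) + 1)) := by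
  rw [← Finset.mul_sum]
  exact mul_le_mul_of_nonneg_left (sum_boxK_le i κ) (mul_nonneg (by positivity) hα₁)

/-- ★ **SUPPORT OF THE VARIATION KERNEL IN THE LABELLED BLOCKS**: `boxK κ f ≠ 0 ⟹ dist(ιB(blkV1(rep κ)), ιB(blkV1 f)) ≦ ℓ + 4` — this lineage's `dist_le_of_boxK_ne_zero_bI` at the
0-faithful section `ιB ∘ blkV1`, moved from `κ` to its representative's labelled block (distance `0`, def-Y's `geo9K_dist_lab_repBondY_self`).
[cite: Balaban1984PropagatorsII, (2.45)–(2.46) p.231; Balaban1985Averaging, p.24 (locality)] -/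
theorem boxK_supp_blkV1 (hι : ∀ s : BlkY i, β i.hN i.D i.hk (ιB s) = s) {κ : IBondY i} {f : FBondY i} (h : boxK i κ f ≠ 0) :
    (geo9K i).dist (ιB (blkV1 i.hN i.D (repBondY i κ))) (ιB (blkV1 i.hN i.D f)) ≤ (ℓ : ℝ) + 4 := by
  have h1 : (geo9K i).dist κ (ιB (blkV1 i.hN i.D f)) ≤ (ℓ : ℝ) + 4 :=
    dist_le_of_boxK_ne_zero_bI i (bI := fun f => ιB (blkV1 i.hN i.D f)) (hβ1_blkV1 i ιB hι) h
  have h0 : (geo9K i).dist (ιB (blkV1 i.hN i.D (repBondY i κ))) κ = 0 := by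
    rw [geo9K_dist_comm]
    exact Node00.geo9K_dist_lab_repBondY_self i ιB hι κ
  linarith [geo9K_dist_triangle i (ιB (blkV1 i.hN i.D (repBondY i κ))) κ (ιB (blkV1 i.hN i.D f))]

/-- ★ **THE PLATEAU AGAINST THE VOLUME**: `vol(κ)·boxK κ f ≦ 1` (`boxK ≦ (Lʲ)^{−(d+1)} = vol(κ)⁻¹`, this lineage's `boxK_le`). [cite: Balaban1985Averaging, (141) p.39, bookkeeping] -/
theorem vol_mul_boxK_le_one (κ : IBondY i) (f : FBondY i) : volY i κ * boxK i κ f ≤ 1 := by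
  have hb : boxK i κ f ≤ ((((ℓ + 1 : ℕ) : ℝ) ^ (d + 1)) ^ lvl i.hN i.D i.hk κ)⁻¹ := by
    have h := boxK_le i κ f; rwa [← pow_mul, mul_comm, pow_mul] at h
  have hv : (0 : ℝ) < volY i κ := volY_pos i κ
  exact (mul_le_mul_of_nonneg_left hb hv.le).trans (le_of_eq (mul_inv_cancel₀ hv.ne'))

/-- ★ **THE BLOCK-RESTRICTED VOLUME-WEIGHTED COLUMN MASS OF THE VARIATION KERNEL**: `Σ_κ 1_{y}(rep κ)·vol(κ)·k80(κ,f) ≦ 2(d+1)·(9∕(2ϱ′))·α₁` — the summands live on the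
carrier fibre `{κ : β κ = β y}` of cardinality `≦ 2(d+1)` (r03's `card_fiber_beta_le`) and each is `≦ (9∕(2ϱ′))·α₁` by the plateau (dag-n06-c's `sum_indB_vol_knitRow_le` pattern).
[cite: Balaban1984PropagatorsII, (2.3) p.224, (2.45) p.231; Balaban1985Averaging, (141) p.39] -/
theorem sum_indB_vol_k80_le (hι : ∀ s : BlkY i, β i.hN i.D i.hk (ιB s) = s) {ϱ' α₁ : ℝ} (hϱ : 0 ≤ ϱ') (hα₁ : 0 ≤ α₁) (f : FBondY i) (y : IBondY i) :
    ∑ κ, indB i ιB y (repBondY i κ) * (volY i κ * (9 / (2 * ϱ') * α₁ * boxK i κ f)) ≤ (2 * ((d : ℝ) + 1)) * (9 / (2 * ϱ') * α₁) := by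
  classical
  set K1 : ℝ := 9 / (2 * ϱ') * α₁ with hK1
  have hK1' : 0 ≤ K1 := by rw [hK1]; exact mul_nonneg (by positivity) hα₁
  set F := Finset.univ.filter fun κ : IBondY i => β i.hN i.D i.hk κ = β i.hN i.D i.hk y with hF
  have hterm : ∀ κ, indB i ιB y (repBondY i κ) * (volY i κ * (9 / (2 * ϱ') * α₁ * boxK i κ f)) ≤ if κ ∈ F then K1 else 0 := by
    intro κ
    by_cases hy : ιB (blkV1 i.hN i.D (repBondY i κ)) = y
    · have hmem : κ ∈ F := by
        rw [hF, Finset.mem_filter]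
        refine ⟨Finset.mem_univ _, ?_⟩
        have hb : blkV1 i.hN i.D (repBondY i κ) = β i.hN i.D i.hk κ := Node00.blkY_repBondY_src i κ
        rw [← hy, hb, hι]
      rw [if_pos hmem, indB_of_eq i ιB hy, one_mul]
      calc volY i κ * (9 / (2 * ϱ') * α₁ * boxK i κ f) = K1 * (volY i κ * boxK i κ f) := by rw [hK1]; ring
        _ ≤ K1 * 1 := mul_le_mul_of_nonneg_left (vol_mul_boxK_le_one i κ f) hK1'
        _ = K1 := mul_one _
    · rw [indB_of_ne i ιB hy, zero_mul]
      split_ifs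
      · exact hK1'
      · exact le_rfl
  calc ∑ κ, indB i ιB y (repBondY i κ) * (volY i κ * (9 / (2 * ϱ') * α₁ * boxK i κ f))
      ≤ ∑ κ, (if κ ∈ F then K1 else 0) := Finset.sum_le_sum fun κ _ => hterm κ
    _ = (F.card : ℝ) * K1 := by rw [Finset.sum_ite_mem, Finset.univ_inter, Finset.sum_const, nsmul_eq_mul]
    _ ≤ (2 * ((d : ℝ) + 1)) * K1 := mul_le_mul_of_nonneg_right (by exact_mod_cast card_fiber_beta_le i.hN i.D i.hk (one_le_k i) _) hK1'

section Adj

variable {N : ℕ} {X Y : Type} [Fintype X] [Fintype Y] [DecidableEq X] [DecidableEq Y]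

omit i [Fintype X] [DecidableEq Y] in
/-- `adjTrY` of a difference of letters is the difference of the `adjTrY`'s (the trace pairing is additive in its first slot) — «Q*_j(U′U) = Q*_j(U) + F*_{2,j}(A)» with `F*_{2,j}` the
variation OF the adjoint letter. [cite: Balaban1985BackgroundPropagators, (3.80) p.406 (last display), p.393 (scalar products)] -/
theorem adjTrY_sub (T T' : (X → Matrix (Fin N) (Fin N) ℂ) →ₗ[ℂ] (Y → Matrix (Fin N) (Fin N) ℂ)) :
    adjTrY (T - T') = adjTrY T - adjTrY T' := by
  apply LinearMap.ext
  intro Ψ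
  funext x
  ext a c
  simp only [adjTrY_apply, LinearMap.sub_apply, Pi.sub_apply, Matrix.sub_apply, trSesqY, star_sub, sub_mul, Finset.sum_sub_distrib]

end Adj

/-! ## §2 ★★ The kernel data of the knit VARIATIONS on (3.35) × (3.37) — the per-`(j, β′, U, a)` conjunct of `hQ80_of_kernels` ∕ `hQL280_of_kernels` -/

section Reg

variable {N : ℕ} [Nonempty (Fin N)]

/-- ★★ **THE KNIT VARIATION KERNEL DATA**: for `G ≤ U(N)`, `U` in `(bg9KP M_N(ℂ) G i).Reg335 c₀ α₀` (`c₀ ≦ 10`, `0 ≦ Mα₀`), a complex `a` with `Lʲη·‖a_μ(x)‖ ≦ α₁` on the two end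
blocks of EVERY index bond (`0 ≦ α₁`, `3α₁ ≦ ϱ′`), the x-free numerics of `B9Eq380QknitVariationY` and a β-section `ιB`: the differences `(QknitY (e^{iηa}U) − QknitY U,
adjTrY (QknitY (e^{iηa}U)) − adjTrY (QknitY U))` are majorised by the kernels `(k80, N⁴·k80)`, `k80 = (9∕(2ϱ′))·α₁·boxK` — rows by `norm_QknitY_mulY_sub_apply_le` (file 2), columns by
`norm_adjTrY_apply_le_of_rowKernel` at the difference operator (`adjTrY_sub`) — with row mass and block-restricted volume-weighted column mass `≦ C80·α₁`,
`C80 = N⁴·(9∕(2ϱ′))·2(d+1)`, and support radius `ℓ + 4` (both keys). [cite: Balaban1985BackgroundPropagators, (3.80)–(3.81) p.406, (3.35)–(3.37) p.396; Balaban1985Averaging, Proposition 7 p.43, (141) p.39; Balaban1984PropagatorsII, (2.45)–(2.46) p.231] -/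
theorem knit_variation_kernel_data {G : Subgroup (Matrix (Fin N) (Fin N) ℂ)ˣ} (hGU : G ≤ unitaryUnits (Matrix (Fin N) (Fin N) ℂ))
    (hι : ∀ s : BlkY i, β i.hN i.D i.hk (ιB s) = s)
    {U : CfgY (Matrix (Fin N) (Fin N) ℂ) i} {c₀ α₀ : ℝ} (hc : c₀ ≤ 10) (hMα : 0 ≤ (kGeo i).M * α₀)
    (hreg : (bg9KP (Matrix (Fin N) (Fin N) ℂ) G i).Reg335 c₀ α₀ U)
    {α₀' : ℝ} (hα' : 0 < α₀') (hα3 : C0 (d + 1) * α₀' ≤ 1 / 3) (hα8 : 8 * α₀' ≤ c2' (d + 1) (ℓ + 1))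
    (hK : Kpl i ((kGeo i).M * α₀) * (kGeo i).L ^ 4 < α₀')
    {ϱ' ϱ : ℝ} (hϱ' : 0 < ϱ') (hϱ : 0 < ϱ)
    (hsmall' : Real.exp (4 * (800 * (((d + 1 : ℕ) : ℝ) + 1) ^ 2 * (((d + 1 : ℕ) : ℝ) + 4)) * α₀')
      * (1 + 8 * (131072 * (((d + 1 : ℕ) : ℝ) + 1) ^ 2) * ϱ') ≤ 2)
    (hc₃' : 2 * ϱ' ≤ c3 (d + 1) (ℓ + 1)) (hϱ'1 : 409600 * (((d + 1 : ℕ) : ℝ) + 1) ^ 2 * ϱ' ≤ 1)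
    (hE : epsCplx (d + 1) (ℓ + 1) ϱ' 0 ≤ 1 / 16)
    (hdX : ((d + 1 : ℕ) : ℝ) * (epsCplx (d + 1) (ℓ + 1) ϱ' 0 + tauCplx (d + 1) (ℓ + 1) α₀' 0 ϱ' 0) ≤ 1 / 16)
    (hsmall : Real.exp (4480 * (((d + 1 : ℕ) : ℝ) + 1) ^ 2 * (((d + 1 : ℕ) : ℝ) + 4) * α₀' + 240000 * (((d + 1 : ℕ) : ℝ) + 1) ^ 3 * ϱ')
      * (1 + 8 * (2097152 * (((d + 1 : ℕ) : ℝ) + 1) ^ 2) * ϱ) ≤ 2)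
    (hc₃ : 2 * ϱ ≤ c3 (d + 1) (ℓ + 1) / 4)
    (a : AfldY (Matrix (Fin N) (Fin N) ℂ) i) {α₁ : ℝ} (hα₁ : 0 ≤ α₁) (hα₁ϱ : 3 * α₁ ≤ ϱ')
    (ha : ∀ (κ : IBondY i) (μ : Fin (d + 1)) (x : Site (PV d ℓ i.m i.K hd hL) 0),
      iterBlockOf (κ.1.1 : ℕ) x = κ.1.2.src ∨ iterBlockOf (κ.1.1 : ℕ) x = κ.1.2.tgt →
        (((ℓ + 1 : ℕ) : ℝ)) ^ (κ.1.1 : ℕ) * (kGeo i).eta * ‖a μ x‖ ≤ α₁) :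
    let k : IBondY i → FBondY i → ℝ := fun κ f => 9 / (2 * ϱ') * α₁ * boxK i κ f
    let ks : IBondY i → FBondY i → ℝ := fun κ f => (N : ℝ) ^ 4 * k κ f
    let C : ℝ := (N : ℝ) ^ 4 * (9 / (2 * ϱ') * (2 * ((d : ℝ) + 1)))
    (∀ κ f, 0 ≤ k κ f) ∧
      (∀ (Λ : FBondY i → Matrix (Fin N) (Fin N) ℂ) κ, ‖QknitY i (decY i (.prod U a)) Λ κ - QknitY i U Λ κ‖ ≤ ∑ f, k κ f * ‖Λ f‖) ∧
      (∀ κ, ∑ f, k κ f ≤ C * α₁) ∧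
      (∀ f (y : IBondY i), ∑ κ, indB i ιB y (repBondY i κ) * (volY i κ * k κ f) ≤ C * α₁) ∧
      (∀ κ f, k κ f ≠ 0 → (geo9K i).dist (blkC i ιB (boxEquiv i.hN (repBondY i κ).src)) (blkC i ιB (boxEquiv i.hN f.src)) ≤ (ℓ : ℝ) + 4) ∧
      (∀ κ f, k κ f ≠ 0 → (geo9K i).dist (ιB (blkV1 i.hN i.D (repBondY i κ))) (ιB (blkV1 i.hN i.D f)) ≤ (ℓ : ℝ) + 4) ∧
    (∀ κ f, 0 ≤ ks κ f) ∧
      (∀ (Ψ : IBondY i → Matrix (Fin N) (Fin N) ℂ) f,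
        ‖adjTrY (QknitY i (decY i (.prod U a))) Ψ f - adjTrY (QknitY i U) Ψ f‖ ≤ ∑ κ, ks κ f * ‖Ψ κ‖) ∧
      (∀ κ, ∑ f, ks κ f ≤ C * α₁) ∧
      (∀ f (y : IBondY i), ∑ κ, indB i ιB y (repBondY i κ) * (volY i κ * ks κ f) ≤ C * α₁) ∧
      (∀ κ f, ks κ f ≠ 0 → (geo9K i).dist (ιB (blkV1 i.hN i.D (repBondY i κ))) (ιB (blkV1 i.hN i.D f)) ≤ (ℓ : ℝ) + 4) := by
  intro k ks C; letI : CStarAlgebra (Matrix (Fin N) (Fin N) ℂ) := {}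
  have hG1 : ∀ u : (Matrix (Fin N) (Fin N) ℂ)ˣ, u ∈ G → ‖(u : Matrix (Fin N) (Fin N) ℂ)‖ ≤ 1 :=
    fun u hu => (B7Prop1Explicit.mem_U1.1 (unitaryUnits_le_U1 (hGU hu))).1
  have hk0 : ∀ κ f, 0 ≤ k κ f := fun κ f => k80_nonneg i hϱ'.le hα₁ κ f
  have hN1 : (1 : ℝ) ≤ (N : ℝ) ^ 4 := one_le_pow₀ (by exact_mod_cast Nat.one_le_iff_ne_zero.2 (Fin.pos_iff_nonempty.2 ‹Nonempty (Fin N)›).ne')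
  set m : ℝ := 9 / (2 * ϱ') * α₁ * (2 * ((d : ℝ) + 1)) with hm
  have hm0 : 0 ≤ m := by rw [hm]; exact mul_nonneg (mul_nonneg (by positivity) hα₁) (by positivity)
  have hmC : m ≤ C * α₁ := by
    have e : C * α₁ = (N : ℝ) ^ 4 * m := by show (N : ℝ) ^ 4 * (9 / (2 * ϱ') * (2 * ((d : ℝ) + 1))) * α₁ = _; rw [hm]; ring
    rw [e]
    calc m = 1 * m := (one_mul _).symm
      _ ≤ (N : ℝ) ^ 4 * m := mul_le_mul_of_nonneg_right hN1 hm0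
  have hmCs : (N : ℝ) ^ 4 * m ≤ C * α₁ := by
    show (N : ℝ) ^ 4 * m ≤ (N : ℝ) ^ 4 * (9 / (2 * ϱ') * (2 * ((d : ℝ) + 1))) * α₁
    rw [hm]; exact le_of_eq (by ring)
  -- the rows of the difference: file 2 at every index bond
  have hrow : ∀ (Λ : FBondY i → Matrix (Fin N) (Fin N) ℂ) κ, ‖QknitY i (decY i (.prod U a)) Λ κ - QknitY i U Λ κ‖ ≤ ∑ f, k κ f * ‖Λ f‖ := by
    intro Λ κ
    have h := norm_QknitY_mulY_sub_apply_le i hG1 hGU hc hMα hreg hα' hα3 hα8 hK hϱ' hϱ hsmall' hc₃' hϱ'1 hE hdX hsmall hc₃ a hα₁ hα₁ϱ κ (ha κ) Λ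
    rw [decY_prod]
    refine (le_of_eq rfl).trans (h.trans (le_of_eq ?_))
    rw [Finset.mul_sum]
    exact Finset.sum_congr rfl fun f _ => by ring
  have hsum : ∀ κ, ∑ f, k κ f ≤ m := fun κ => sum_k80_le i hϱ'.le hα₁ κ
  have hsumV : ∀ f (y : IBondY i), ∑ κ, indB i ιB y (repBondY i κ) * (volY i κ * k κ f) ≤ m := fun f y => by
    refine (sum_indB_vol_k80_le i ιB hι hϱ'.le hα₁ f y).trans (le_of_eq ?_)
    rw [hm]; ring
  have hsuppV : ∀ κ f, k κ f ≠ 0 → (geo9K i).dist (ιB (blkV1 i.hN i.D (repBondY i κ))) (ιB (blkV1 i.hN i.D f)) ≤ (ℓ : ℝ) + 4 :=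
    fun κ f h => boxK_supp_blkV1 i ιB hι fun hb => h (by show 9 / (2 * ϱ') * α₁ * boxK i κ f = 0; rw [hb, mul_zero])
  -- the `blkC ιB ∘ boxEquiv ∘ src` key is the `ιB ∘ blkV1` key by `rfl`
  have hsuppC : ∀ κ f, k κ f ≠ 0 → (geo9K i).dist (blkC i ιB (boxEquiv i.hN (repBondY i κ).src)) (blkC i ιB (boxEquiv i.hN f.src)) ≤ (ℓ : ℝ) + 4 :=
    hsuppV
  -- the columns of the adjoint difference: transposed row kernel
  have hcol : ∀ (Ψ : IBondY i → Matrix (Fin N) (Fin N) ℂ) f,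
      ‖adjTrY (QknitY i (decY i (.prod U a))) Ψ f - adjTrY (QknitY i U) Ψ f‖ ≤ ∑ κ, ks κ f * ‖Ψ κ‖ := by
    intro Ψ f
    have hrow' : ∀ (Λ : FBondY i → Matrix (Fin N) (Fin N) ℂ) (κ : IBondY i),
        ‖(QknitY i (decY i (.prod U a)) - QknitY i U) Λ κ‖ ≤ ∑ f', k κ f' * ‖Λ f'‖ := fun Λ κ => by
      rw [LinearMap.sub_apply, Pi.sub_apply]; exact hrow Λ κ
    have h := norm_adjTrY_apply_le_of_rowKernel i (QknitY i (decY i (.prod U a)) - QknitY i U) k hk0 hrow' Ψ f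
    rw [adjTrY_sub, LinearMap.sub_apply, Pi.sub_apply] at h
    refine h.trans (le_of_eq ?_)
    rw [Finset.mul_sum]
    exact Finset.sum_congr rfl fun κ _ => by ring
  refine ⟨hk0, hrow, fun κ => (hsum κ).trans hmC, fun f y => (hsumV f y).trans hmC, hsuppC, hsuppV,
    fun κ f => mul_nonneg (by positivity) (hk0 κ f), hcol, fun κ => ?_, fun f y => ?_, fun κ f h => hsuppV κ f ?_⟩
  · calc ∑ f, ks κ f = (N : ℝ) ^ 4 * ∑ f, k κ f := by rw [Finset.mul_sum]
      _ ≤ (N : ℝ) ^ 4 * m := mul_le_mul_of_nonneg_left (hsum κ) (by positivity)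
      _ ≤ C * α₁ := hmCs
  · calc ∑ κ, indB i ιB y (repBondY i κ) * (volY i κ * ks κ f)
        = (N : ℝ) ^ 4 * ∑ κ, indB i ιB y (repBondY i κ) * (volY i κ * k κ f) := by
          rw [Finset.mul_sum]; exact Finset.sum_congr rfl fun κ _ => by ring
      _ ≤ (N : ℝ) ^ 4 * m := mul_le_mul_of_nonneg_left (hsumV f y) (by positivity)
      _ ≤ C * α₁ := hmCs
  · intro hk; apply h
    show (N : ℝ) ^ 4 * k κ f = 0
    rw [hk, mul_zero]

end Reg

/-! ## §3 ★★★ The binders `hQ80` ∕ `hQL280` at the knit pair of a member family -/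

section Members

variable {N : ℕ} [Nonempty (Fin N)] {ι : Type} [Fintype ι]
variable {Mstar : ℕ} (P : RegExtraY d ℓ hd hL b₀ b₁ Mstar (Matrix (Fin N) (Fin N) ℂ)) {J : Type} (f : J → MemberY d ℓ hd hL b₀ b₁ Mstar)
  [instF : ∀ x : MemberY d ℓ hd hL b₀ b₁ Mstar, Fintype (geo9Y x).Site]
  (c35 : ℝ) (G : Subgroup (Matrix (Fin N) (Fin N) ℂ)ˣ)
  (𝔮 : ∀ j : J, CfgY (Matrix (Fin N) (Fin N) ℂ) (f j).toKIdx → ((FBondY (f j).toKIdx → Matrix (Fin N) (Fin N) ℂ) →ₗ[ℂ] (IBondY (f j).toKIdx → Matrix (Fin N) (Fin N) ℂ)))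
  (𝔮s : ∀ j : J, CfgY (Matrix (Fin N) (Fin N) ℂ) (f j).toKIdx → ((IBondY (f j).toKIdx → Matrix (Fin N) (Fin N) ℂ) →ₗ[ℂ] (FBondY (f j).toKIdx → Matrix (Fin N) (Fin N) ℂ)))
  (b : Module.Basis ι ℝ (Matrix (Fin N) (Fin N) ℂ)) (ιBf : ∀ j : J, BlkY (f j).toKIdx → IBondY (f j).toKIdx)
  (C37 : ∀ j : J, ℝ → CfgY (Matrix (Fin N) (Fin N) ℂ) (f j).toKIdx → AfldY (Matrix (Fin N) (Fin N) ℂ) (f j).toKIdx → Prop)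
  (hGU : G ≤ unitaryUnits (Matrix (Fin N) (Fin N) ℂ))
  (hι : ∀ (j : J) (s : BlkY (f j).toKIdx), β (f j).hN (f j).D (f j).hk (ιBf j s) = s) {M₂ : ℝ} (hM₂ : 0 ≤ M₂)
  (hrepr : ∀ (v : Matrix (Fin N) (Fin N) ℂ) (j : ι), |b.repr v j| ≤ M₂ * ‖v‖)
  (h𝔮 : ∀ (j : J) (U : CfgY (Matrix (Fin N) (Fin N) ℂ) (f j).toKIdx), 𝔮 j U = QknitY (f j).toKIdx U)
  (h𝔮s : ∀ (j : J) (U : CfgY (Matrix (Fin N) (Fin N) ℂ) (f j).toKIdx), 𝔮s j U = adjTrY (QknitY (f j).toKIdx U))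
  -- KC's standing regime bridge and knit numerics
  {aInv c₀ : ℝ} (hc : c₀ ≤ 10)
  (hRP : ∀ (j : J) (α₀ : ℝ) (U : CfgY (Matrix (Fin N) (Fin N) ℂ) (f j).toKIdx),
    (bg9YC (Matrix (Fin N) (Fin N) ℂ) G P (f j)).Reg335 c35 α₀ U → (bg9KP (Matrix (Fin N) (Fin N) ℂ) G (f j).toKIdx).Reg335 c₀ α₀ U)
  {α₀' : ℝ} (hα' : 0 < α₀') (hα3 : C0 (d + 1) * α₀' ≤ 1 / 3) (hα8 : 8 * α₀' ≤ c2' (d + 1) (ℓ + 1))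
  (hKpl : ∀ (j : J) (a : ℝ), 0 ≤ a → a ≤ aInv → Kpl (f j).toKIdx a * (kGeo (f j).toKIdx).L ^ 4 < α₀')
  -- the x-free Prop-7∕Prop-5 window of `B9Eq380QknitVariationY`
  {ϱ' ϱ : ℝ} (hϱ' : 0 < ϱ') (hϱ : 0 < ϱ)
  (hsmall' : Real.exp (4 * (800 * (((d + 1 : ℕ) : ℝ) + 1) ^ 2 * (((d + 1 : ℕ) : ℝ) + 4)) * α₀')
    * (1 + 8 * (131072 * (((d + 1 : ℕ) : ℝ) + 1) ^ 2) * ϱ') ≤ 2)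
  (hc₃' : 2 * ϱ' ≤ c3 (d + 1) (ℓ + 1)) (hϱ'1 : 409600 * (((d + 1 : ℕ) : ℝ) + 1) ^ 2 * ϱ' ≤ 1)
  (hE : epsCplx (d + 1) (ℓ + 1) ϱ' 0 ≤ 1 / 16)
  (hdX : ((d + 1 : ℕ) : ℝ) * (epsCplx (d + 1) (ℓ + 1) ϱ' 0 + tauCplx (d + 1) (ℓ + 1) α₀' 0 ϱ' 0) ≤ 1 / 16)
  (hsmall : Real.exp (4480 * (((d + 1 : ℕ) : ℝ) + 1) ^ 2 * (((d + 1 : ℕ) : ℝ) + 4) * α₀' + 240000 * (((d + 1 : ℕ) : ℝ) + 1) ^ 3 * ϱ')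
    * (1 + 8 * (2097152 * (((d + 1 : ℕ) : ℝ) + 1) ^ 2) * ϱ) ≤ 2)
  (hc₃ : 2 * ϱ ≤ c3 (d + 1) (ℓ + 1) / 4)
  -- the three displayed laws of the instance's class `C37` (node00-def-Y's (K3) shape)
  {cA : ℝ} (hcA : 0 ≤ cA)
  (hC37R : ∀ (j : J) (β' : ℝ) (U : CfgY (Matrix (Fin N) (Fin N) ℂ) (f j).toKIdx) (a : AfldY (Matrix (Fin N) (Fin N) ℂ) (f j).toKIdx),
    C37 j β' U a → ∃ α₀ : ℝ, 0 < α₀ ∧ (geo9Y (f j)).M * α₀ ≤ aInv ∧ (bg9YC (Matrix (Fin N) (Fin N) ℂ) G P (f j)).Reg335 c35 α₀ U)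
  (hC37A : ∀ (j : J) (β' : ℝ) (U : CfgY (Matrix (Fin N) (Fin N) ℂ) (f j).toKIdx) (a : AfldY (Matrix (Fin N) (Fin N) ℂ) (f j).toKIdx),
    C37 j β' U a → ∀ (κ : IBondY (f j).toKIdx) (μ : Fin (d + 1)) (x : Site (PV d ℓ (f j).toKIdx.m (f j).toKIdx.K hd hL) 0),
      iterBlockOf (κ.1.1 : ℕ) x = κ.1.2.src ∨ iterBlockOf (κ.1.1 : ℕ) x = κ.1.2.tgt →
        (((ℓ + 1 : ℕ) : ℝ)) ^ (κ.1.1 : ℕ) * (kGeo (f j).toKIdx).eta * ‖a μ x‖ ≤ cA * β')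
  (hC37ϱ : ∀ (j : J) (β' : ℝ) (U : CfgY (Matrix (Fin N) (Fin N) ℂ) (f j).toKIdx) (a : AfldY (Matrix (Fin N) (Fin N) ℂ) (f j).toKIdx),
    C37 j β' U a → 3 * (cA * β') ≤ ϱ')

omit instF in
include hGU hι h𝔮 h𝔮s hc hRP hα' hα3 hα8 hKpl hϱ' hϱ hsmall' hc₃' hϱ'1 hE hdX hsmall hc₃ hcA hC37R hC37A hC37ϱ in
/-- the per-`(j, β′, U, a)` kernel data of the knit variations on the class, in `hQ80_of_kernels ∕ hQL280_of_kernels`' `hker` shape (kernels `k80 ∕ N⁴k80` at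
`α₁ := cA·β′`, masses `≦ (C80·cA)·β′`). [cite: Balaban1985BackgroundPropagators, (3.80)–(3.81) p.406, (3.35)–(3.37) p.396; Balaban1985Averaging, Proposition 7 p.43] -/
theorem hker_knit :
    ∀ j (β' : ℝ) (U : CfgY (Matrix (Fin N) (Fin N) ℂ) (f j).toKIdx) (a : AfldY (Matrix (Fin N) (Fin N) ℂ) (f j).toKIdx), 0 < β' → C37 j β' U a →
      (∀ κ f', 0 ≤ 9 / (2 * ϱ') * (cA * β') * boxK (f j).toKIdx κ f') ∧
        (∀ (Λ : FBondY (f j).toKIdx → Matrix (Fin N) (Fin N) ℂ) κ, ‖𝔮 j (decY (f j).toKIdx (.prod U a)) Λ κ - 𝔮 j U Λ κ‖ ≤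
          ∑ f', 9 / (2 * ϱ') * (cA * β') * boxK (f j).toKIdx κ f' * ‖Λ f'‖) ∧
        (∀ κ, ∑ f', 9 / (2 * ϱ') * (cA * β') * boxK (f j).toKIdx κ f' ≤ ((N : ℝ) ^ 4 * (9 / (2 * ϱ') * (2 * ((d : ℝ) + 1))) * cA) * β') ∧
        (∀ f' (y : IBondY (f j).toKIdx), ∑ κ, indB (f j).toKIdx (ιBf j) y (repBondY (f j).toKIdx κ) *
            (volY (f j).toKIdx κ * (9 / (2 * ϱ') * (cA * β') * boxK (f j).toKIdx κ f')) ≤ ((N : ℝ) ^ 4 * (9 / (2 * ϱ') * (2 * ((d : ℝ) + 1))) * cA) * β') ∧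
        (∀ κ f', 9 / (2 * ϱ') * (cA * β') * boxK (f j).toKIdx κ f' ≠ 0 →
          (geo9K (f j).toKIdx).dist (blkC (f j).toKIdx (ιBf j) (boxEquiv (f j).toKIdx.hN (repBondY (f j).toKIdx κ).src))
            (blkC (f j).toKIdx (ιBf j) (boxEquiv (f j).toKIdx.hN f'.src)) ≤ (ℓ : ℝ) + 4) ∧
        (∀ κ f', 9 / (2 * ϱ') * (cA * β') * boxK (f j).toKIdx κ f' ≠ 0 →
          (geo9K (f j).toKIdx).dist (ιBf j (blkV1 (f j).toKIdx.hN (f j).toKIdx.D (repBondY (f j).toKIdx κ))) (ιBf j (blkV1 (f j).toKIdx.hN (f j).toKIdx.D f')) ≤ (ℓ : ℝ) + 4) ∧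
      (∀ κ f', 0 ≤ (N : ℝ) ^ 4 * (9 / (2 * ϱ') * (cA * β') * boxK (f j).toKIdx κ f')) ∧
        (∀ (Ψ : IBondY (f j).toKIdx → Matrix (Fin N) (Fin N) ℂ) f', ‖𝔮s j (decY (f j).toKIdx (.prod U a)) Ψ f' - 𝔮s j U Ψ f'‖ ≤
          ∑ κ, (N : ℝ) ^ 4 * (9 / (2 * ϱ') * (cA * β') * boxK (f j).toKIdx κ f') * ‖Ψ κ‖) ∧
        (∀ κ, ∑ f', (N : ℝ) ^ 4 * (9 / (2 * ϱ') * (cA * β') * boxK (f j).toKIdx κ f') ≤ ((N : ℝ) ^ 4 * (9 / (2 * ϱ') * (2 * ((d : ℝ) + 1))) * cA) * β') ∧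
        (∀ f' (y : IBondY (f j).toKIdx), ∑ κ, indB (f j).toKIdx (ιBf j) y (repBondY (f j).toKIdx κ) *
            (volY (f j).toKIdx κ * ((N : ℝ) ^ 4 * (9 / (2 * ϱ') * (cA * β') * boxK (f j).toKIdx κ f'))) ≤ ((N : ℝ) ^ 4 * (9 / (2 * ϱ') * (2 * ((d : ℝ) + 1))) * cA) * β') ∧
        (∀ κ f', (N : ℝ) ^ 4 * (9 / (2 * ϱ') * (cA * β') * boxK (f j).toKIdx κ f') ≠ 0 →
          (geo9K (f j).toKIdx).dist (ιBf j (blkV1 (f j).toKIdx.hN (f j).toKIdx.D (repBondY (f j).toKIdx κ))) (ιBf j (blkV1 (f j).toKIdx.hN (f j).toKIdx.D f')) ≤ (ℓ : ℝ) + 4) := by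
  intro j β' U a hβ' hCl
  obtain ⟨α₀, hα₀, hMa, hU⟩ := hC37R j β' U a hCl
  have hMx : 0 ≤ (geo9Y (f j)).M := by
    show (0 : ℝ) ≤ ((ℓ + 1 : ℕ) : ℝ) * ((f j).toKIdx.Mh : ℝ); positivity
  have hMα : 0 ≤ (kGeo (f j).toKIdx).M * α₀ := mul_nonneg hMx hα₀.le
  have hK : Kpl (f j).toKIdx ((kGeo (f j).toKIdx).M * α₀) * (kGeo (f j).toKIdx).L ^ 4 < α₀' := hKpl j _ hMα hMa
  have hα₁ : 0 ≤ cA * β' := mul_nonneg hcA hβ'.le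
  obtain ⟨h1, h2, h3, h4, h5, h6, h7, h8, h9, h10, h11⟩ :=
    knit_variation_kernel_data (f j).toKIdx (ιBf j) hGU (hι j) hc hMα (hRP j α₀ U hU) hα' hα3 hα8 hK hϱ' hϱ hsmall' hc₃' hϱ'1 hE hdX hsmall hc₃ a hα₁
      (hC37ϱ j β' U a hCl) (hC37A j β' U a hCl)
  have eC : (N : ℝ) ^ 4 * (9 / (2 * ϱ') * (2 * ((d : ℝ) + 1))) * (cA * β') = ((N : ℝ) ^ 4 * (9 / (2 * ϱ') * (2 * ((d : ℝ) + 1))) * cA) * β' := by ring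
  refine ⟨h1, fun Λ κ => ?_, fun κ => (h3 κ).trans (le_of_eq eC), fun f' y => (h4 f' y).trans (le_of_eq eC), h5, h6, h7, fun Ψ f' => ?_,
    fun κ => (h9 κ).trans (le_of_eq eC), fun f' y => (h10 f' y).trans (le_of_eq eC), h11⟩
  · rw [h𝔮 j, h𝔮 j U]; exact h2 Λ κ
  · rw [h𝔮s j, h𝔮s j U]; exact h8 Ψ f'

include hGU hι hM₂ hrepr h𝔮 h𝔮s hc hRP hα' hα3 hα8 hKpl hϱ' hϱ hsmall' hc₃' hϱ'1 hE hdX hsmall hc₃ hcA hC37R hC37A hC37ϱ in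
/-- ★★★ **`hQ80` AT THE KNIT PAIR**: the block-sup (3.80)–(3.81) variation law of the K2-G frames, inhabited for the knit pair of a member family on the instance's class `C37`
from its three displayed laws, KC's regime bridge ∕ knit numerics and the x-free window; `cF := (M₂Σ‖b_j‖)·(N⁴·(9∕(2ϱ′))·2(d+1)·cA)·e^{ℓ+4}`.
[cite: Balaban1985BackgroundPropagators, (3.80)–(3.81) p.406, Thm 3.4 p.400, (3.35)–(3.37) p.396; Balaban1985Averaging, Proposition 7 p.43; Balaban1984PropagatorsII, (2.51) p.232] -/
theorem hQ80_knit :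
    ∀ j (β' : ℝ) (U : CfgY (Matrix (Fin N) (Fin N) ℂ) (f j).toKIdx) (a : AfldY (Matrix (Fin N) (Fin N) ℂ) (f j).toKIdx), 0 < β' → C37 j β' U a →
      ∀ δ : ℝ, 0 < δ → δ ≤ 1 →
      HasMajorant (g := toB6 (geo9Y (f j)) 0 True) (fun q : (Fin (d + 1) × SiteY (f j).toKIdx) × ι => blkC (f j).toKIdx (ιBf j) q.1.2)
          (F₂QC (f j).toKIdx (𝔮 j) b (.base U) (.mult a))
          (fun a₁ a₂ => ((M₂ * ∑ j, ‖b j‖) * ((N : ℝ) ^ 4 * (9 / (2 * ϱ') * (2 * ((d : ℝ) + 1))) * cA) * Real.exp ((ℓ : ℝ) + 4)) * β' *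
            Real.exp (-(δ * (geo9Y (f j)).dist a₁ a₂))) ∧
        HasMajorant (g := toB6 (geo9Y (f j)) 0 True) (fun q : (Fin (d + 1) × SiteY (f j).toKIdx) × ι => blkC (f j).toKIdx (ιBf j) q.1.2)
          (F₂sQC (f j).toKIdx (𝔮s j) b (.base U) (.mult a))
          (fun a₁ a₂ => ((M₂ * ∑ j, ‖b j‖) * ((N : ℝ) ^ 4 * (9 / (2 * ϱ') * (2 * ((d : ℝ) + 1))) * cA) * Real.exp ((ℓ : ℝ) + 4)) * β' *
            Real.exp (-(δ * (geo9Y (f j)).dist a₁ a₂))) :=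
  hQ80_of_kernels (Mstar := Mstar) b f 𝔮 𝔮s ιBf C37 hM₂ hrepr
    (C := (N : ℝ) ^ 4 * (9 / (2 * ϱ') * (2 * ((d : ℝ) + 1))) * cA) (r := (ℓ : ℝ) + 4) (by positivity) (by positivity)
    (fun j β' _ _ κ f' => 9 / (2 * ϱ') * (cA * β') * boxK (f j).toKIdx κ f')
    (fun j β' _ _ κ f' => (N : ℝ) ^ 4 * (9 / (2 * ϱ') * (cA * β') * boxK (f j).toKIdx κ f'))
    fun j β' U a hβ' hCl => by
      obtain ⟨h1, h2, h3, -, h5, -, h7, h8, -, h10, h11⟩ :=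
        hker_knit P f c35 G 𝔮 𝔮s ιBf C37 hGU hι h𝔮 h𝔮s hc hRP hα' hα3 hα8 hKpl hϱ' hϱ hsmall' hc₃' hϱ'1 hE hdX hsmall hc₃ hcA hC37R hC37A hC37ϱ j β' U a hβ' hCl
      exact ⟨h1, h2, h3, h5, h7, h8, h10, h11⟩

include hGU hι hM₂ hrepr h𝔮 h𝔮s hc hRP hα' hα3 hα8 hKpl hϱ' hϱ hsmall' hc₃' hϱ'1 hE hdX hsmall hc₃ hcA hC37R hC37A hC37ϱ in
/-- ★★★ **`hQL280` AT THE KNIT PAIR**: the block-`ℓ²` variation law, inhabited likewise; `cF2 := (√|ι|·M₂Σ‖b_j‖)·(N⁴·(9∕(2ϱ′))·2(d+1)·cA)·e^{ℓ+4}`.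
[cite: Balaban1985BackgroundPropagators, (3.80)–(3.81) p.406, (3.46) p.398; Balaban1985Averaging, Proposition 7 p.43; Balaban1984PropagatorsII, Prop. 2.6 (2.140) p.247, (2.51) p.232] -/
theorem hQL280_knit [∀ x : MemberY d ℓ hd hL b₀ b₁ Mstar, DecidableEq (geo9Y x).Site] :
    ∀ j (β' : ℝ) (U : CfgY (Matrix (Fin N) (Fin N) ℂ) (f j).toKIdx) (a : AfldY (Matrix (Fin N) (Fin N) ℂ) (f j).toKIdx), 0 < β' → C37 j β' U a →
      ∀ δ : ℝ, 0 < δ → δ ≤ 1 →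
      HasL2Majorant (g := toB6 (geo9Y (f j)) 0 True) (fun q : (Fin (d + 1) × SiteY (f j).toKIdx) × ι => blkC (f j).toKIdx (ιBf j) q.1.2)
          (F₂QC2 (f j).toKIdx (𝔮 j) b (.base U) (.mult a))
          (fun a₁ a₂ => ((Real.sqrt (Fintype.card ι) * M₂ * ∑ j, ‖b j‖) * ((N : ℝ) ^ 4 * (9 / (2 * ϱ') * (2 * ((d : ℝ) + 1))) * cA) * Real.exp ((ℓ : ℝ) + 4)) * β' *
            Real.exp (-(δ * (geo9Y (f j)).dist a₁ a₂))) ∧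
        HasL2Majorant (g := toB6 (geo9Y (f j)) 0 True) (fun q : (Fin (d + 1) × SiteY (f j).toKIdx) × ι => blkC (f j).toKIdx (ιBf j) q.1.2)
          (F₂sQC2 (f j).toKIdx (𝔮s j) b (.base U) (.mult a))
          (fun a₁ a₂ => ((Real.sqrt (Fintype.card ι) * M₂ * ∑ j, ‖b j‖) * ((N : ℝ) ^ 4 * (9 / (2 * ϱ') * (2 * ((d : ℝ) + 1))) * cA) * Real.exp ((ℓ : ℝ) + 4)) * β' *
            Real.exp (-(δ * (geo9Y (f j)).dist a₁ a₂))) :=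
  hQL280_of_kernels (Mstar := Mstar) b f 𝔮 𝔮s ιBf C37 hM₂ hrepr
    (C := (N : ℝ) ^ 4 * (9 / (2 * ϱ') * (2 * ((d : ℝ) + 1))) * cA) (r := (ℓ : ℝ) + 4) (by positivity) (by positivity)
    (fun j β' _ _ κ f' => 9 / (2 * ϱ') * (cA * β') * boxK (f j).toKIdx κ f')
    (fun j β' _ _ κ f' => (N : ℝ) ^ 4 * (9 / (2 * ϱ') * (cA * β') * boxK (f j).toKIdx κ f'))
    fun j β' U a hβ' hCl => by
      obtain ⟨h1, h2, h3, h4, -, h6, h7, h8, h9, h10, h11⟩ :=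
        hker_knit P f c35 G 𝔮 𝔮s ιBf C37 hGU hι h𝔮 h𝔮s hc hRP hα' hα3 hα8 hKpl hϱ' hϱ hsmall' hc₃' hϱ'1 hE hdX hsmall hc₃ hcA hC37R hC37A hC37ϱ j β' U a hβ' hCl
      exact ⟨h1, h2, h3, h4, h6, h7, h8, h9, h10, h11⟩

end Members


end Summit.QuantumFields.YangMills.BalabanUVNodes.N06SectBQVarLawsKnit

end
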